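import Summits.BirchSwinnertonDyer.BirchSwinnertonDyer.Theorems.ByReductionTypeAtTwoOrdEisensteinHalfShaAlgebra
import Summits.BirchSwinnertonDyer.Rank1Residual.X1.GeneratorBoundMu
import HarnessLib

/-!
# The `μ`-shift along a pseudo-isogeny of `Λ`-modules: pure algebra behind the ISOGENY TRANSPORT of
# the `2`-adic main conjecture at analytic rank `0` (route ByReductionTypeAtTwo / TwoAdicConverse,
# cruxes `OrdKatoHalfAtTwo` / `OrdEisensteinHalfAtTwo`, item stmt-BirchSwinnertonDyer-19272;
# seat bsd-2adic-ord-3, GEN 3)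

HONEST FRAMING (cell `bsd-2adic`, HUMAN RULINGS D-0036/D-0074): THEOREMS ONLY, pure commutative
algebra over `Λ = ℤ_p⟦T⟧` (any prime `p`) — no definition, no named fact, nothing asserted, closes
nothing. Structure theory of `Λ`-modules enters through the tree's PROVED facts
(`exists_isPseudoIsomorphism_elementary_holds`, `charIdeal_eq_span_holds`,
`charIdeal_mul_of_shortExact_holds`, `lambdaInvariant_eq_sum_natDegree_holds`).

WHY (GEN 2's one named gap, `…OrdEisensteinHalfShaIsogeny.lean`: «what does NOT transport for free
along isogenies is the Kato half itself — the `μ`-invariant of `X` shifts under `2`-isogenies»). An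
isogeny `φ : E → E'` and its dual give `Λ`-linear maps `F : X(E') → X(E)`, `G : X(E) → X(E')` with
`F ∘ G = G ∘ F = deg φ`. This file proves what such a PSEUDO-ISOGENY does to characteristic power
series:

* §1 `exists_charGen_eq_C_pow_mul_unit`: a finitely generated torsion `Λ`-module killed by a
  non-zero constant `c ∈ ℤ_p` has characteristic power series `p^a · (unit)` (its `λ` vanishes:
  `ℚ_p ⊗_{ℤ_p} K = 0`).
* §2 `exists_C_pow_mul_unit_mul_charGen_eq`: if `F : N → M`, `G : M → N` are `Λ`-linear with
  `G ∘ F = c`, `F ∘ G = c` (`c ∈ ℤ_p ∖ 0`), then the generators satisfy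
  `p^a · u · f_M = p^b · v · f_N` for units `u, v` — the two characteristic ideals differ by a power of
  `(p)` (char is multiplicative along `0 → ker F → N → im F → 0` and `0 → im F → M → M/im F → 0`,
  and `ker F`, `M/im F` are killed by `c`).
* §3 `valuation_constantCoeff_sub_mu_eq`: hence, when `f_M(0) ≠ 0`, the ROOT MASS
  `ord_p f(0) − μ` is the same for `f_M` and `f_N`: **`μ(M) − μ(N) = ord_p f_M(0) − ord_p f_N(0)`**
  (`muInvariant_sub_eq_valuation_sub`). This is the algebraic half of the `μ`-shift law
  `μ(E) − μ(E') = ord_p(Ω_{E'}/Ω_E)` (Perrin-Riou / Schneider) which the sequel derives AT ANALYTIC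
  RANK `0` from Greenberg's Euler-characteristic formula and Cassels' theorem instead.

References: L. Washington, GTM 83, §13.2 (structure theory, multiplicativity of characteristic
ideals); R. Greenberg, LNM 1716 (1999), §4 (Thm. 4.1) and §5 (`μ` under isogeny, p. 121);
P. Schneider, *The μ-invariant of isogenies*, J. Indian Math. Soc. 52 (1987); B. Perrin-Riou,
*Arithmétique des courbes elliptiques et théorie d'Iwasawa*, Mém. SMF 17 (1984), Appendix.
-/

set_option autoImplicit false
set_option linter.dupNamespace false

noncomputable section

open scoped Classical TensorProduct

open Literature.NumberTheory.EllipticCurves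
  Summit.BirchSwinnertonDyer.Rank1Residual.X1.MuLambda
  Summit.BirchSwinnertonDyer.Rank1Residual.X1.MuPart
  Summit.BirchSwinnertonDyer.Rank1Residual.X1.ParitySqueeze
  Summit.BirchSwinnertonDyer.Rank1Residual.X1.GeneratorBoundMu
  Summit.BirchSwinnertonDyer.Rank1Residual.Additive.TameBranchLambdaParity
  Summit.BirchSwinnertonDyer.BirchSwinnertonDyer.Theorems.EisensteinShaCurrency

universe u v

namespace Summit.BirchSwinnertonDyer.BirchSwinnertonDyer.Theorems.IsogenyMuShift

variable {p : ℕ} [Fact p.Prime]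

/-! ## §0 Small helpers: torsion and finiteness of sub- and quotient modules -/

/-- A submodule of a torsion module is torsion. [folklore] -/
theorem isTorsion_submodule {R : Type*} [CommRing R] {M : Type*} [AddCommGroup M] [Module R M]
    (hM : Module.IsTorsion R M) (S : Submodule R M) : Module.IsTorsion R S := by
  intro x
  obtain ⟨a, ha⟩ := @hM (x : M)
  exact ⟨a, Subtype.ext (by rw [Submonoid.smul_def, Submodule.coe_smul, Submodule.coe_zero]; exact ha)⟩

/-- A quotient of a torsion module is torsion. [folklore] -/
theorem isTorsion_quotient {R : Type*} [CommRing R] {M : Type*} [AddCommGroup M] [Module R M]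
    (hM : Module.IsTorsion R M) (S : Submodule R M) : Module.IsTorsion R (M ⧸ S) := by
  intro x
  obtain ⟨m, rfl⟩ := Submodule.Quotient.mk_surjective S x
  obtain ⟨a, ha⟩ := @hM m
  have ha' : (a : R) • m = 0 := ha
  refine ⟨a, ?_⟩
  change (a : R) • (Submodule.Quotient.mk m : M ⧸ S) = 0
  rw [← Submodule.Quotient.mk_smul, ha', Submodule.Quotient.mk_zero]

/-- A submodule of a finitely generated `Λ`-module is finitely generated (`Λ` is Noetherian).
[folklore] -/
theorem moduleFinite_submodule {M : Type*} [AddCommGroup M] [Module (IwasawaAlgebra p) M]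
    [Module.Finite (IwasawaAlgebra p) M] (S : Submodule (IwasawaAlgebra p) M) :
    Module.Finite (IwasawaAlgebra p) S :=
  Module.Finite.iff_fg.mpr (IsNoetherian.noetherian S)

/-! ## §1 Modules killed by a non-zero constant have characteristic power series `p^a · unit` -/

/-- If the non-zero constant `c ∈ ℤ_p` kills the `Λ`-module `K`, then `ℚ_p ⊗_{ℤ_p} K = 0`, so
`λ(K) = 0`. [cite: Washington1997, §13.2 (λ = rank_{ℤ_p})] -/
theorem lambdaInvariant_eq_zero_of_C_smul_eq_zero {K : Type*} [AddCommGroup K]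
    [Module (IwasawaAlgebra p) K] {c : ℤ_[p]} (hc : c ≠ 0)
    (hK : ∀ x : K, (PowerSeries.C c : IwasawaAlgebra p) • x = 0) : lambdaInvariant p K = 0 := by
  letI iK : Module ℤ_[p] K := Module.compHom K (algebraMap ℤ_[p] (IwasawaAlgebra p))
  have hunit : IsUnit (algebraMap ℤ_[p] ℚ_[p] c) := by
    rw [isUnit_iff_ne_zero]
    exact PadicInt.coe_ne_zero.2 hc
  haveI : Subsingleton (ℚ_[p] ⊗[ℤ_[p]] K) := by
    refine ⟨fun x y ↦ ?_⟩
    have hz : ∀ z : ℚ_[p] ⊗[ℤ_[p]] K, z = 0 := by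
      intro z
      induction z using TensorProduct.induction_on with
      | zero => rfl
      | tmul a k =>
        refine Module.tmul_eq_zero_of_pow_smul_eq_zero ℚ_[p] hunit (n := 1) ?_ a
        change (algebraMap ℤ_[p] (IwasawaAlgebra p) (c ^ 1)) • k = 0
        rw [pow_one, ← PowerSeries.C_eq_algebraMap]
        exact hK k
      | add x y hx hy => rw [hx, hy, add_zero]
    rw [hz x, hz y]
  change Module.finrank ℚ_[p] (ℚ_[p] ⊗[ℤ_[p]] K) = 0
  exact Module.finrank_zero_of_subsingleton

/-- **A finitely generated torsion `Λ`-module killed by a non-zero constant `c ∈ ℤ_p` has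
characteristic ideal `(p^a · u)` with `u ∈ Λˣ`**: a generator `g ≠ 0` exists (structure theorem),
`λ(g) = λ(K) = 0`, so the `p`-free part of `g` is a unit. [cite: Washington1997, §13.2] -/
theorem exists_charGen_eq_C_pow_mul_unit (K : Type u) [AddCommGroup K] [Module (IwasawaAlgebra p) K]
    [Module.Finite (IwasawaAlgebra p) K] (hKt : Module.IsTorsion (IwasawaAlgebra p) K)
    {c : ℤ_[p]} (hc : c ≠ 0) (hK : ∀ x : K, (PowerSeries.C c : IwasawaAlgebra p) • x = 0) :
    ∃ (a : ℕ) (u : (IwasawaAlgebra p)ˣ),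
      Module.charIdeal (IwasawaAlgebra p) K =
        Ideal.span {PowerSeries.C ((p : ℤ_[p]) ^ a) * (u : IwasawaAlgebra p)} := by
  obtain ⟨g, hg0, hg⟩ := exists_charGenerator_ne_zero (p := p) K hKt
  have hlam : lam g = 0 := by
    rw [lam_generator_eq_lambdaInvariant K hKt hg0 hg, lambdaInvariant_eq_zero_of_C_smul_eq_zero hc hK]
  obtain ⟨u, hu⟩ := isUnit_pfree_of_lam_eq_zero hg0 hlam
  refine ⟨mu g, u, ?_⟩
  rw [hg, hu, ← eq_C_pow_mu_mul_pfree g]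

/-! ## §2 A pseudo-isogeny pair `F ∘ G = c = G ∘ F` makes the characteristic power series differ by a power of `p` -/

section PseudoIsogeny

variable {M : Type u} {N : Type v} [AddCommGroup M] [Module (IwasawaAlgebra p) M]
  [AddCommGroup N] [Module (IwasawaAlgebra p) N]

/-- **Characteristic power series along a pseudo-isogeny.** Let `M`, `N` be finitely generated
torsion `Λ`-modules, `F : N → M`, `G : M → N` `Λ`-linear with `G ∘ F = c` on `N` and `F ∘ G = c` on
`M` for a non-zero constant `c ∈ ℤ_p`, and `char M = (f_M)`, `char N = (f_N)`. Then
`p^a · u · f_M = p^b · v · f_N` for some `a, b ∈ ℕ` and units `u, v`. Proof: char is multiplicative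
along `0 → ker F → N → im F → 0` and `0 → im F → M → M/im F → 0`, and `ker F`, `M/im F` are
killed by `c`, so their characteristic power series are `p^a·unit`, `p^b·unit` (§1).
[cite: Washington1997, §13.2] [cite: GreenbergLNM1716, §4 (isogenous curves, pseudo-isomorphism up to p-power)] -/
theorem exists_C_pow_mul_unit_mul_charGen_eq [Module.Finite (IwasawaAlgebra p) M]
    [Module.Finite (IwasawaAlgebra p) N] (hM : Module.IsTorsion (IwasawaAlgebra p) M)
    (hN : Module.IsTorsion (IwasawaAlgebra p) N) (F : N →ₗ[IwasawaAlgebra p] M)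
    (G : M →ₗ[IwasawaAlgebra p] N) {c : ℤ_[p]} (hc : c ≠ 0)
    (hGF : ∀ x : N, G (F x) = (PowerSeries.C c : IwasawaAlgebra p) • x)
    (hFG : ∀ y : M, F (G y) = (PowerSeries.C c : IwasawaAlgebra p) • y)
    {fM fN : IwasawaAlgebra p} (hfM : Module.charIdeal (IwasawaAlgebra p) M = Ideal.span {fM})
    (hfN : Module.charIdeal (IwasawaAlgebra p) N = Ideal.span {fN}) :
    ∃ (a b : ℕ) (u v : (IwasawaAlgebra p)ˣ),
      PowerSeries.C ((p : ℤ_[p]) ^ a) * (u : IwasawaAlgebra p) * fM =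
        PowerSeries.C ((p : ℤ_[p]) ^ b) * (v : IwasawaAlgebra p) * fN := by
  set R : Submodule (IwasawaAlgebra p) M := LinearMap.range F with hR
  -- finiteness / torsion of the three auxiliary modules
  haveI : Module.Finite (IwasawaAlgebra p) (LinearMap.ker F) := moduleFinite_submodule _
  haveI : Module.Finite (IwasawaAlgebra p) R := moduleFinite_submodule _
  haveI : Module.Finite (IwasawaAlgebra p) (M ⧸ R) := inferInstance
  have hKt : Module.IsTorsion (IwasawaAlgebra p) (LinearMap.ker F) := isTorsion_submodule hN _
  have hRt : Module.IsTorsion (IwasawaAlgebra p) R := isTorsion_submodule hM _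
  have hQt : Module.IsTorsion (IwasawaAlgebra p) (M ⧸ R) := isTorsion_quotient hM _
  -- `ker F` and `M / im F` are killed by `c`
  have hKc : ∀ x : LinearMap.ker F, (PowerSeries.C c : IwasawaAlgebra p) • x = 0 := by
    intro x
    apply Subtype.ext
    rw [Submodule.coe_smul, Submodule.coe_zero, ← hGF, LinearMap.map_coe_ker, map_zero]
  have hQc : ∀ y : M ⧸ R, (PowerSeries.C c : IwasawaAlgebra p) • y = 0 := by
    intro y
    obtain ⟨m, rfl⟩ := Submodule.Quotient.mk_surjective R y
    rw [← Submodule.Quotient.mk_smul, ← hFG, Submodule.Quotient.mk_eq_zero, hR]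
    exact LinearMap.mem_range_self F (G m)
  -- characteristic power series of the four pieces
  obtain ⟨a, u₁, hker⟩ := exists_charGen_eq_C_pow_mul_unit (LinearMap.ker F) hKt hc hKc
  obtain ⟨b, u₂, hquot⟩ := exists_charGen_eq_C_pow_mul_unit (M ⧸ R) hQt hc hQc
  obtain ⟨gR, -, hgR⟩ := exists_charGenerator_ne_zero (p := p) R hRt
  -- the two short exact sequences
  have hexact₁ : Function.Exact (LinearMap.ker F).subtype F.rangeRestrict :=
    LinearMap.exact_iff.mpr (by rw [LinearMap.ker_rangeRestrict, Submodule.range_subtype])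
  have hN_mul := charIdeal_mul_of_shortExact_holds p N hN (LinearMap.ker F).subtype F.rangeRestrict
    (Submodule.subtype_injective _) F.surjective_rangeRestrict hexact₁
  have hM_mul := charIdeal_mul_of_shortExact_holds p M hM R.subtype R.mkQ
    (Submodule.subtype_injective _) (Submodule.mkQ_surjective R) (LinearMap.exact_subtype_mkQ R)
  -- `(f_N) = (p^a u₁ · gR)`, `(f_M) = (gR · p^b u₂)`
  rw [hfN, hker, hgR, Ideal.span_singleton_mul_span_singleton] at hN_mul
  rw [hfM, hgR, hquot, Ideal.span_singleton_mul_span_singleton] at hM_mul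
  obtain ⟨w₁, hw₁⟩ := Ideal.span_singleton_eq_span_singleton.mp hN_mul
  obtain ⟨w₂, hw₂⟩ := Ideal.span_singleton_eq_span_singleton.mp hM_mul
  -- `f_N · w₁ = p^a u₁ gR`, `f_M · w₂ = gR p^b u₂`
  refine ⟨a, b, w₂ * u₁, w₁ * u₂, ?_⟩
  rw [Units.val_mul, Units.val_mul]
  calc PowerSeries.C ((p : ℤ_[p]) ^ a) * ((w₂ : IwasawaAlgebra p) * u₁) * fM
      = PowerSeries.C ((p : ℤ_[p]) ^ a) * u₁ * (fM * w₂) := by ring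
    _ = PowerSeries.C ((p : ℤ_[p]) ^ a) * u₁ * (gR * (PowerSeries.C ((p : ℤ_[p]) ^ b) * u₂)) := by
        rw [hw₂]
    _ = PowerSeries.C ((p : ℤ_[p]) ^ b) * u₂ * (PowerSeries.C ((p : ℤ_[p]) ^ a) * u₁ * gR) := by ring
    _ = PowerSeries.C ((p : ℤ_[p]) ^ b) * u₂ * (fN * w₁) := by rw [hw₁]
    _ = PowerSeries.C ((p : ℤ_[p]) ^ b) * ((w₁ : IwasawaAlgebra p) * u₂) * fN := by ring

end PseudoIsogeny

/-! ## §3 Consequences of `p^a · u · f = p^b · v · g`: equal `λ`, shifted `μ`, equal root mass -/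

section Consequences

/-- `μ` of a unit multiple: `μ(u · f) = μ(f)`. [folklore] -/
theorem mu_units_mul (u : (IwasawaAlgebra p)ˣ) {f : IwasawaAlgebra p} (hf : f ≠ 0) :
    mu ((u : IwasawaAlgebra p) * f) = mu f := by
  rw [mu_mul u.ne_zero hf, ((isUnit_iff_mu_eq_zero_and_lam_eq_zero _).mp u.isUnit).2.1, zero_add]

/-- `λ` of a unit multiple: `λ(u · f) = λ(f)`. [folklore] -/
theorem lam_units_mul (u : (IwasawaAlgebra p)ˣ) {f : IwasawaAlgebra p} (hf : f ≠ 0) :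
    lam ((u : IwasawaAlgebra p) * f) = lam f := by
  rw [lam_mul u.ne_zero hf, lam_eq_zero_of_isUnit u.isUnit, zero_add]

/-- **`μ` shifts by `b − a`**: from `p^a·u·f = p^b·v·g` (`f, g ≠ 0`): `a + μ(f) = b + μ(g)`. [folklore] -/
theorem mu_add_eq_mu_add {f g : IwasawaAlgebra p} (hf : f ≠ 0) (hg : g ≠ 0) {a b : ℕ}
    {u v : (IwasawaAlgebra p)ˣ}
    (h : PowerSeries.C ((p : ℤ_[p]) ^ a) * (u : IwasawaAlgebra p) * f =
      PowerSeries.C ((p : ℤ_[p]) ^ b) * (v : IwasawaAlgebra p) * g) :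
    a + mu f = b + mu g := by
  have h1 := (mu_and_pfree_C_pow_mul (mul_ne_zero u.ne_zero hf) a).1
  have h2 := (mu_and_pfree_C_pow_mul (mul_ne_zero v.ne_zero hg) b).1
  rw [mu_units_mul u hf] at h1
  rw [mu_units_mul v hg] at h2
  rw [mul_assoc, mul_assoc] at h
  rw [← h1, ← h2, h]

/-- **`λ` is invariant**: from `p^a·u·f = p^b·v·g` (`f, g ≠ 0`): `λ(f) = λ(g)`. [folklore] -/
theorem lam_eq_lam {f g : IwasawaAlgebra p} (hf : f ≠ 0) (hg : g ≠ 0) {a b : ℕ}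
    {u v : (IwasawaAlgebra p)ˣ}
    (h : PowerSeries.C ((p : ℤ_[p]) ^ a) * (u : IwasawaAlgebra p) * f =
      PowerSeries.C ((p : ℤ_[p]) ^ b) * (v : IwasawaAlgebra p) * g) :
    lam f = lam g := by
  have h1 := lam_C_pow_mul a (mul_ne_zero u.ne_zero hf)
  have h2 := lam_C_pow_mul b (mul_ne_zero v.ne_zero hg)
  rw [lam_units_mul u hf] at h1
  rw [lam_units_mul v hg] at h2
  rw [mul_assoc, mul_assoc] at h
  rw [← h1, ← h2, h]

/-- The constant term of a unit of `Λ` is a unit of `ℤ_p`, hence has valuation `0`. [folklore] -/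
theorem valuation_constantCoeff_units (u : (IwasawaAlgebra p)ˣ) :
    (PowerSeries.constantCoeff (u : IwasawaAlgebra p)).valuation = 0 := by
  have hu : IsUnit (PowerSeries.constantCoeff (u : IwasawaAlgebra p)) :=
    PowerSeries.isUnit_constantCoeff _ u.isUnit
  exact (isUnit_iff_valuation_eq_zero hu.ne_zero).mp hu

/-- **Constant terms shift by the same amount**: from `p^a·u·f = p^b·v·g` with `f(0) ≠ 0`:
`g(0) ≠ 0` and `a + ord_p f(0) = b + ord_p g(0)`. [folklore] -/
theorem valuation_constantCoeff_add_eq {f g : IwasawaAlgebra p}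
    (hf0 : PowerSeries.constantCoeff f ≠ 0) {a b : ℕ} {u v : (IwasawaAlgebra p)ˣ}
    (h : PowerSeries.C ((p : ℤ_[p]) ^ a) * (u : IwasawaAlgebra p) * f =
      PowerSeries.C ((p : ℤ_[p]) ^ b) * (v : IwasawaAlgebra p) * g) :
    PowerSeries.constantCoeff g ≠ 0 ∧
      a + (PowerSeries.constantCoeff f).valuation = b + (PowerSeries.constantCoeff g).valuation := by
  have hp : (p : ℤ_[p]) ≠ 0 := by exact_mod_cast (Fact.out : p.Prime).ne_zero
  have hu0 : PowerSeries.constantCoeff (u : IwasawaAlgebra p) ≠ 0 :=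
    (PowerSeries.isUnit_constantCoeff _ u.isUnit).ne_zero
  have hv0 : PowerSeries.constantCoeff (v : IwasawaAlgebra p) ≠ 0 :=
    (PowerSeries.isUnit_constantCoeff _ v.isUnit).ne_zero
  have e := congrArg PowerSeries.constantCoeff h
  rw [map_mul, map_mul, map_mul, map_mul, PowerSeries.constantCoeff_C, PowerSeries.constantCoeff_C] at e
  have hlhs : (p : ℤ_[p]) ^ a * PowerSeries.constantCoeff (u : IwasawaAlgebra p) *
      PowerSeries.constantCoeff f ≠ 0 := mul_ne_zero (mul_ne_zero (pow_ne_zero _ hp) hu0) hf0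
  have hg0 : PowerSeries.constantCoeff g ≠ 0 := by
    intro h0
    rw [h0, mul_zero] at e
    exact hlhs e
  refine ⟨hg0, ?_⟩
  have ev := congrArg PadicInt.valuation e
  rw [PadicInt.valuation_mul (mul_ne_zero (pow_ne_zero _ hp) hu0) hf0,
    PadicInt.valuation_mul (pow_ne_zero _ hp) hu0,
    PadicInt.valuation_mul (mul_ne_zero (pow_ne_zero _ hp) hv0) hg0,
    PadicInt.valuation_mul (pow_ne_zero _ hp) hv0, valuation_constantCoeff_units,
    valuation_constantCoeff_units, PadicInt.valuation_pow, PadicInt.valuation_pow,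
    PadicInt.valuation_p] at ev
  simpa using ev

/-- **Equal root mass.** From `p^a·u·f = p^b·v·g` with `f(0) ≠ 0` (`f, g ≠ 0`):
`ord_p f(0) − μ(f) = ord_p g(0) − μ(g)` — the valuation of the constant term of the `p`-FREE part is
an invariant of the pseudo-isogeny class. [cite: Washington1997, §7.1 (Weierstrass preparation) and §13.2] -/
theorem valuation_constantCoeff_sub_mu_eq {f g : IwasawaAlgebra p}
    (hf0 : PowerSeries.constantCoeff f ≠ 0) {a b : ℕ} {u v : (IwasawaAlgebra p)ˣ}
    (h : PowerSeries.C ((p : ℤ_[p]) ^ a) * (u : IwasawaAlgebra p) * f =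
      PowerSeries.C ((p : ℤ_[p]) ^ b) * (v : IwasawaAlgebra p) * g) :
    ((PowerSeries.constantCoeff f).valuation : ℤ) - mu f =
      ((PowerSeries.constantCoeff g).valuation : ℤ) - mu g := by
  obtain ⟨hg0, hval⟩ := valuation_constantCoeff_add_eq hf0 h
  have hμ := mu_add_eq_mu_add (ne_zero_of_constantCoeff_ne_zero hf0)
    (ne_zero_of_constantCoeff_ne_zero hg0) h
  omega

end Consequences

/-! ## §4 Module-level packaging: `μ(M) − μ(N) = ord_p f_M(0) − ord_p f_N(0)` along a pseudo-isogeny -/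

section ModuleLevel

variable {M : Type u} {N : Type v} [AddCommGroup M] [Module (IwasawaAlgebra p) M]
  [AddCommGroup N] [Module (IwasawaAlgebra p) N]

/-- **THE ALGEBRAIC `μ`-SHIFT LAW.** `M`, `N` finitely generated torsion `Λ`-modules linked by a
pseudo-isogeny pair `F : N → M`, `G : M → N` (`G ∘ F = c = F ∘ G`, `c ∈ ℤ_p ∖ 0`), generators `f_M`,
`f_N` of the characteristic ideals with `f_M(0) ≠ 0`. Then `f_N(0) ≠ 0`, `λ(f_M) = λ(f_N)`, and
`μ(M) + ord_p f_N(0) = μ(N) + ord_p f_M(0)`: the `μ`-invariant moves EXACTLY as the constant term of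
the characteristic power series. For `X(E/ℚ_∞)`, `X(E'/ℚ_∞)` of isogenous curves of analytic rank `0`
the right-hand side is computed by Greenberg's Thm. 4.1 (sequel file).
[cite: Washington1997, §13.2] [cite: GreenbergLNM1716, Thm. 4.1 (p. 102) and §5 (p. 121: μ under isogeny)] -/
theorem muInvariant_add_valuation_eq [Module.Finite (IwasawaAlgebra p) M]
    [Module.Finite (IwasawaAlgebra p) N] (hM : Module.IsTorsion (IwasawaAlgebra p) M)
    (hN : Module.IsTorsion (IwasawaAlgebra p) N) (F : N →ₗ[IwasawaAlgebra p] M)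
    (G : M →ₗ[IwasawaAlgebra p] N) {c : ℤ_[p]} (hc : c ≠ 0)
    (hGF : ∀ x : N, G (F x) = (PowerSeries.C c : IwasawaAlgebra p) • x)
    (hFG : ∀ y : M, F (G y) = (PowerSeries.C c : IwasawaAlgebra p) • y)
    {fM fN : IwasawaAlgebra p} (hfM : Module.charIdeal (IwasawaAlgebra p) M = Ideal.span {fM})
    (hfN : Module.charIdeal (IwasawaAlgebra p) N = Ideal.span {fN})
    (hfM0 : PowerSeries.constantCoeff fM ≠ 0) :
    PowerSeries.constantCoeff fN ≠ 0 ∧ lam fM = lam fN ∧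
      (muInvariant p M : ℤ) + (PowerSeries.constantCoeff fN).valuation =
        (muInvariant p N : ℤ) + (PowerSeries.constantCoeff fM).valuation := by
  obtain ⟨a, b, u, v, h⟩ := exists_C_pow_mul_unit_mul_charGen_eq hM hN F G hc hGF hFG hfM hfN
  obtain ⟨hfN0, -⟩ := valuation_constantCoeff_add_eq hfM0 h
  have hfM' : fM ≠ 0 := ne_zero_of_constantCoeff_ne_zero hfM0
  have hfN' : fN ≠ 0 := ne_zero_of_constantCoeff_ne_zero hfN0
  have hroot := valuation_constantCoeff_sub_mu_eq hfM0 h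
  have hμM : mu fM = muInvariant p M := mu_generator_eq_muInvariant M hM hfM' hfM
  have hμN : mu fN = muInvariant p N := mu_generator_eq_muInvariant N hN hfN' hfN
  refine ⟨hfN0, lam_eq_lam hfM' hfN' h, ?_⟩
  rw [← hμM, ← hμN]
  omega

end ModuleLevel

end Summit.BirchSwinnertonDyer.BirchSwinnertonDyer.Theorems.IsogenyMuShift

end
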